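/-
Copyright: lit-balaban Phase-2 proof seat p08 (gen 8).  Statement-level skeleton of a published paper; no proof claims beyond what
the kernel checks below.
-/
import Literature.MathematicalPhysics.QuantumFieldTheory.BalabanImbrieJaffe1984to88.BIJ88Decay223CkKernel

/-!
# `BalabanImbrieJaffe1984to88.BIJ88Decay223CkTerm` — T. Bałaban, J. Imbrie, A. Jaffe, *Effective action and cluster properties of the
abelian Higgs model*, Commun. Math. Phys. **114** (1988) 257–315 [BalabanImbrieJaffe1988]: **(2.22)–(2.23)** p. 262 — THE KERNEL OF THE
`C_k` OF RECORD ON THE TORI, file 2 of 3 (the scale-`j` term): for seat p08 g7's `BIJ88Eq220Torus.CkE P hd η_k^d L^k k` ((2.22) verbatim),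
the scale-`j` term `(D_jC^{(j)}H_j^*∂*Q^{e*}_k∂₁e_{b′})(x)` of its kernel is exponentially small in `L^{k−j}·dist(x, b′)` — the p. 262 sentence
*"The kernels of all these operators have an exponential decay on their respective length scales"* made quantitative from the entrywise
bounds of file 1 (`BIJ88Decay223CkKernel`: `D_j` = [I] (7.2.4) kernel of record, the source `∂₁e_{b′}` local and `ℓ¹`-small) and the
(2.16) file's bounds for `u^{(j)}_p = H_j^*∂*Q^{e*}_ke_p` and its three-kernel lattice sum (`BIJ88Decay216Torus`, p08 g7); file 3 =
`BIJ88Decay223CkTorus` (the sum over `j`, (2.23) from [6I] Prop. 1.2 alone)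

statement-level skeleton of published theorems with citation tags; proofs where landed; nothing here is a claim about the Yang–Mills mass gap

PDF held: `paper:balaban1988-cmp114-bij-abelian-higgs-effective-action` (journal page = PDF page + 256), p. 262 [PDF 6] (text layer
`~/.lit/texts/paper-balaban1988-cmp114-bij-abelian-higgs-effective-action/p0006.txt`, re-read this session); [I] = [BalabanImbrieJaffe1985]
pp. 325–326 (7.2.2)–(7.2.4).

CITATION HEADER (lean-in-tree rule).  Part of the lit-balaban TYPED SKELETON (HOME `run/shared/lean/pub/lit-balaban/`), Phase-2 proof
seat p08 (gen 8), unit `lit-balaban-p08`; WHAT IS REPRODUCED = SKELETON row **C2.Eq2.23** (reader file `HOME/lit-balaban-r18/ROWS-C2.md`,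
owner r18, referee ref-5; head *"proved p249538 (p08 g4; hence-step …)"*), kind «model instance for the operator of record» (row
**C2.Eq2.22**, p08 g7 p255966), joined to rows **C1.Eq7.2.1-7.2.2** / **C1.Eq7.2.3** / **C1.Eq7.2.4** (the entrywise inputs, as hypotheses
of printed shape here; discharged in file 3) and **C2.Eq2.16** (`BIJ88Decay216Torus.abs_coord_le`/`triple_sum_le` by name).  TAKING line
HOME/STATUS.md 2026-08-21T18:13:52Z (B).  Decls used BY NAME (nothing restated): file 1 (`termCk_eq_sum`, `dOne_single_apply`,
`abs_DjE_single_le`, `supDist_le_one_of_curl_single_ne_zero`, `sum_abs_curl_single_le`); p08 g7's `BIJ88Decay216Torus.abs_coord_le`,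
`triple_sum_le`; p09's `torusRep`, `ctr`, `distEU`, `supDist_ctr_ctr`; p30's `dOne`; p11's `HkE`, `CE`; `Balaban1983to89.B5…eta_pow_mul_eta_inv_pow`.

THE PRINTED TEXT (p. 262 [PDF 6], verbatim): *"C_k = D_k + Σ_{j=0}^{k−1} D^{L^jη}_jC^{(j),L^jη}H^{*L^jη}_j∂*Q^{e*}_k∂. (2.22) The kernels of all
these operators have an exponential decay on their respective length scales; for D_k the required estimate is (I.7.2.4). The sum over j is not
well controlled for close points; this will not be important for us. For more distant points, however, the rapid decay of terms with small j
controls the scalings and the sum over j to yield a uniform bound |C_k(x,b′)| ≦ ce^{−c dist(x,b′)}, dist(x,b′) > c. (2.23)"*.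

THE TORUS DATA: as in file 1 (normalisation of record `w = η_k^d`, `c = L^k`; `dist(x, b′) := distEU P k x b′₋ = |x − ctr_k(b′₋)|_∞/L^k`;
`u^{(j)}_p := H_j^*∂*Q^{e*}_ke_p`; `H_{j,μν}(x; y)` = the (7.2.1) kernel of p09's `torusRep P j (deltaAData …)`).

WHAT IS PROVED (0 `sorry`, standard axioms; theorems only — proof lane; `j ≤ k ≤ m + K`, `d ≥ 2`):
* §1 **`abs_tripleCk_le`**: `|Σ_{b₁,b₂∈T^{(j)}} D_j(x,b₁)·⟨e_{b₁}, C^{(j)}e_{b₂}⟩·u^{(j)}_p(b₂)| ≤ 2d³M²e^{δ}M_{C,j}e^{δL^{k−j}}K₀·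
  e^{−a₀|x − ctr_k p₋|_∞/L^j}`, `a₀ = min(δ,δ_C)/2`, `K₀ = e^{a₀/2}(2(1+d/a₀))^{2d}` — given the `|H|` and `|∇H|` members of (7.2.2) for `H_j`
  (constants `M, δ`) and a (7.2.3)-shape bound `M_{C,j}e^{−δ_C|b₁₋−b₂₋|_∞}` for the matrix of `CE P η_k^d L^k j`: file 1's `abs_DjE_single_le`
  (factor `d·L^{j−k}Me^{δ}`), the (2.16) file's `abs_coord_le` (factor `L^{k−j}·2M·e^{δL^{k−j}}`) — the scalings `L^{j−k}·L^{k−j}` CANCEL — and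
  `triple_sum_le`.
* §2 **`abs_termCk_le`**: `|(D_jC^{(j)}H_j^*∂*Q^{e*}_k∂₁e_{b′})(x)| ≤ N_∂·(2d³M²e^{δ}M_{C,j}K₀)·e^{(δ+a₀)L^{k−j}}·e^{−a₀L^{k−j}·dist(x,b′)}`,
  `N_∂ = 4e^d d²(2(1+1))^d` — file 1's `termCk_eq_sum`, §1 at each source plaquette adjacent to `b′`, and the `ℓ¹` bound of the source.
HONEST SCOPE.  (i) Per-scale bound only, the three inputs as hypotheses of printed shape; the sum over `j` and the discharge are in file 3.
(ii) `U = 1`, real abelian fields, torus, standing range.  (iii) Constants explicit, not optimal.  (iv) No `def`, no new named fact, nothing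
restated; NOT summit progress.  Unit `lit-balaban-p08` (literature-prover-lit-balaban-p08-g8-0), 2026-08-21.
-/

open scoped BigOperators RealInnerProductSpace

namespace Literature.MathematicalPhysics.QuantumFieldTheory.BalabanImbrieJaffe1984to88.BIJ88Decay223CkTerm

open Balaban1983to89 hiding Site Plaq
open Balaban1983to89.LatticeFieldCalculus
open Balaban1983to89.B3TorusRadialSums (supDist_comm supDist_eq_zero_iff)
open BIJ88SigmaKernelDkTorus BIJ88Ineq217Ineq722Torus BIJ88Ineq217NearPart BIJ88Decay216Torus
open BIJ85AxialPropagator411 BIJ85Prop521Torus BIJ85Sigma421Torus BIJ85Prop522Torus BIJ85Sigma422Eta BIJ85Prop511Torus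
open BIJ85Eq611Torus (dOne)
open BIJ85Sect7Statements BIJ85Ineq722Torus BIJ85Eq721MinimizerKernel
open BIJ85Ineq722DeltaA (deltaAData)
open BIJ88Eq220Torus (DjE CkE)
open BIJ88Decay223CkKernel

open Balaban1983to89 renaming Site → TSite, Plaq → TPlaq

noncomputable section

variable {P : Params}

/-- `0 < L^n` in `ℝ`. [folklore] -/
private theorem cast_pow_L_pos' (n : ℕ) : (0 : ℝ) < (P.L : ℝ) ^ n := pow_pos P.cast_L_pos n

/-! ## §1  The double sum of the scale-`j` term at a source plaquette -/

/-- a sum over the unit bonds of `T^{(j)}` of a function of the initial point is `d` times the sum over the sites (p08 g7's private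
lemma, re-proved). [folklore] -/
private theorem sum_bond_src {j : ℕ} (f : TSite P j → ℝ) : ∑ b : PBond P j, f b.src = (P.d : ℝ) * ∑ y : TSite P j, f y := by
  rw [← Fintype.sum_equiv (LatticeFieldCalculus.bondEquiv (P := P) (j := j)) (fun q : TSite P j × Fin P.d => f q.1) _
    (fun q => rfl), Fintype.sum_prod_type]
  simp only [Finset.sum_const, Finset.card_univ, Fintype.card_fin, nsmul_eq_mul]
  rw [Finset.mul_sum]

/-- **THE DOUBLE SUM OF THE SCALE-`j` TERM AT A SOURCE PLAQUETTE `p` IS EXPONENTIALLY SMALL IN THE DISTANCE FROM `x` TO THE BLOCK OF `p`**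
(normalisation of record `w = η_k^d`, `c = L^k`; `j ≤ k ≤ m + K`): `|Σ_{b₁,b₂∈T^{(j)}} D_j(x,b₁)·⟨e_{b₁}, C^{(j)}e_{b₂}⟩·u^{(j)}_p(b₂)| ≤
2d³M²e^{δ}M_{C,j}e^{δL^{k−j}}K₀·e^{−a₀|x − ctr_k p₋|_∞/L^j}`, `a₀ = min(δ, δ_C)/2`, `K₀ = e^{a₀/2}(2(1 + d/a₀))^{2d}` — given the `|H|` and the
`|∇H|` members of (7.2.2) for `H_j` (constants `M, δ`) and a (7.2.3)-shape bound `M_{C,j}e^{−δ_C|b₁₋ − b₂₋|_∞}` for the matrix of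
`CE P η_k^d L^k j`: §3 for `D_j(x,b₁)` (factor `d·L^{j−k}Me^{δ}`), the (2.16) file's `abs_coord_le` for `u^{(j)}_p(b₂)` (factor
`L^{k−j}·2M·e^{δL^{k−j}}`, decay from the centre of the block of `p`) — the scalings `L^{j−k}·L^{k−j}` CANCEL — and its three-kernel lattice
sum `triple_sum_le`. [cite: BalabanImbrieJaffe1988, (2.23) p.262] -/
theorem abs_tripleCk_le (hd : 2 ≤ P.d) {k : ℕ} (hk : k ≤ P.m + P.K) {j : ℕ} (hj : j ≤ P.m + P.K) (hjk : j ≤ k)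
    {a : ℝ} (ha : 0 < a) {δ M δC MCj : ℝ} (hδ : 0 < δ) (hδC : 0 < δC) (hM : 0 ≤ M) (hMCj : 0 ≤ MCj)
    (hH : ∀ (μ ν : Fin P.d) (x'' : TSite P 0) (y : TSite P j),
      |(torusRep P j (deltaAData hj a)).H (x'', μ) (y, ν)| ≤ M * Real.exp (-(δ * distEU P j x'' y)))
    (hB : ∀ (μ ν : Fin P.d) (x : TSite P 0) (y : TSite P j),
      ‖fun lam : Fin P.d => (P.L : ℝ) ^ j *
          ((torusRep P j (deltaAData hj a)).H (x.shift lam, μ) (y, ν) - (torusRep P j (deltaAData hj a)).H (x, μ) (y, ν))‖ ≤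
        M * Real.exp (-(δ * distEU P j x y)))
    (hC : ∀ b b' : PBond P j, |⟪toEj P j (Pi.single b 1),
      CE P ((P.eta k) ^ P.d) ((P.L : ℝ) ^ k) j (toEj P j (Pi.single b' 1))⟫| ≤ MCj * Real.exp (-(δC * (supDist b.src b'.src : ℝ))))
    (x : TSite P 0) (p : TPlaq P k) :
    |∑ b₁ : PBond P j, ∑ b₂ : PBond P j, DjE P ((P.eta k) ^ P.d) ((P.L : ℝ) ^ k) j (toEj P j (Pi.single b₁ 1)) x *
        ⟪toEj P j (Pi.single b₁ 1), CE P ((P.eta k) ^ P.d) ((P.L : ℝ) ^ k) j (toEj P j (Pi.single b₂ 1))⟫ *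
        LinearMap.adjoint (HkE P ((P.eta k) ^ P.d) ((P.L : ℝ) ^ k) j)
          (LinearMap.adjoint (curlOp (P := P) ((P.eta k) ^ P.d) ((P.L : ℝ) ^ k))
            (QesOp (P := P) hd ((P.eta k) ^ P.d) k (toU P k (Pi.single p 1)))) b₂| ≤
      2 * (P.d : ℝ) ^ 3 * M ^ 2 * Real.exp δ * MCj * Real.exp (δ * (P.L : ℝ) ^ (k - j)) *
        (Real.exp (min δ δC / 2 / 2) * ((2 * (1 + P.d / (min δ δC / 2))) ^ P.d) ^ 2) *
        Real.exp (-(min δ δC / 2 * ((supDist x (ctr k p.src) : ℝ) / (P.L : ℝ) ^ j))) := by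
  have hw : 0 < (P.eta k) ^ P.d := pow_pos (eta_pos P k) _
  have hLk : (P.L : ℝ) ^ k ≠ 0 := (cast_pow_L_pos' k).ne'
  have hW : (P.eta k) ^ P.d * ((P.eta k)⁻¹) ^ P.d = 1 := eta_pow_mul_eta_inv_pow P k
  set ℓ : ℝ := (P.L : ℝ) ^ (k - j) with hℓ
  have hℓeq : |(P.L : ℝ) ^ k| / (P.L : ℝ) ^ j = ℓ := by
    rw [abs_of_pos (cast_pow_L_pos' k), hℓ, div_eq_iff (cast_pow_L_pos' j).ne', ← pow_add, Nat.sub_add_cancel hjk]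
  have hℓeq' : (P.L : ℝ) ^ j / (P.L : ℝ) ^ k = ℓ⁻¹ := by
    rw [hℓ, ← inv_div, ← abs_of_pos (cast_pow_L_pos' (P := P) k), hℓeq]
  -- entrywise constants
  set ED : ℝ := (P.d : ℝ) * ℓ⁻¹ * (M * Real.exp δ) with hED
  set EU : ℝ := ℓ * (2 * M) * Real.exp (δ * ℓ) with hEU
  have hED0 : 0 ≤ ED := by positivity
  have hEU0 : 0 ≤ EU := by positivity
  set x₂ := ctr k p.src with hx₂
  have hpt : ∀ b₁ b₂ : PBond P j,
      |DjE P ((P.eta k) ^ P.d) ((P.L : ℝ) ^ k) j (toEj P j (Pi.single b₁ 1)) x *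
          ⟪toEj P j (Pi.single b₁ 1), CE P ((P.eta k) ^ P.d) ((P.L : ℝ) ^ k) j (toEj P j (Pi.single b₂ 1))⟫ *
          LinearMap.adjoint (HkE P ((P.eta k) ^ P.d) ((P.L : ℝ) ^ k) j)
            (LinearMap.adjoint (curlOp (P := P) ((P.eta k) ^ P.d) ((P.L : ℝ) ^ k))
              (QesOp (P := P) hd ((P.eta k) ^ P.d) k (toU P k (Pi.single p 1)))) b₂| ≤
        ED * MCj * EU * (Real.exp (-(δ * distEU P j x b₁.src)) * Real.exp (-(δC * (supDist b₁.src b₂.src : ℝ))) *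
          Real.exp (-(δ * distEU P j x₂ b₂.src))) := by
    intro b₁ b₂
    rw [abs_mul, abs_mul]
    have h1 := abs_DjE_single_le (k := k) hj hw ha hδ.le hM hH x b₁
    rw [hℓeq'] at h1
    have h2 := abs_coord_le hd hk hj hjk hLk hw ha hδ.le hB p b₂
    rw [hW, one_mul, hℓeq] at h2
    have h3 := hC b₁ b₂
    calc _ ≤ (ED * Real.exp (-(δ * distEU P j x b₁.src))) * (MCj * Real.exp (-(δC * (supDist b₁.src b₂.src : ℝ)))) *
          (EU * Real.exp (-(δ * distEU P j x₂ b₂.src))) :=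
          mul_le_mul (mul_le_mul h1 h3 (abs_nonneg _) (by positivity)) h2 (abs_nonneg _) (by positivity)
      _ = _ := by ring
  calc _ ≤ ∑ b₁ : PBond P j, ∑ b₂ : PBond P j, ED * MCj * EU * (Real.exp (-(δ * distEU P j x b₁.src)) *
          Real.exp (-(δC * (supDist b₁.src b₂.src : ℝ))) * Real.exp (-(δ * distEU P j x₂ b₂.src))) :=
        (Finset.abs_sum_le_sum_abs _ _).trans (Finset.sum_le_sum fun b₁ _ =>
          (Finset.abs_sum_le_sum_abs _ _).trans (Finset.sum_le_sum fun b₂ _ => hpt b₁ b₂))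
    _ = ED * MCj * EU * ((P.d : ℝ) * ∑ y : TSite P j, (P.d : ℝ) * ∑ y' : TSite P j, Real.exp (-(δ * distEU P j x y)) *
          Real.exp (-(δC * (supDist y y' : ℝ))) * Real.exp (-(δ * distEU P j x₂ y'))) := by
        rw [← sum_bond_src (fun y => (P.d : ℝ) * ∑ y' : TSite P j, Real.exp (-(δ * distEU P j x y)) *
          Real.exp (-(δC * (supDist y y' : ℝ))) * Real.exp (-(δ * distEU P j x₂ y'))), Finset.mul_sum]
        refine Finset.sum_congr rfl fun b _ => ?_
        rw [← sum_bond_src (fun y' => Real.exp (-(δ * distEU P j x b.src)) * Real.exp (-(δC * (supDist b.src y' : ℝ))) *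
          Real.exp (-(δ * distEU P j x₂ y'))), Finset.mul_sum]
    _ = ED * MCj * EU * (P.d : ℝ) ^ 2 * ∑ y : TSite P j, ∑ y' : TSite P j, Real.exp (-(δ * distEU P j x y)) *
          Real.exp (-(δC * (supDist y y' : ℝ))) * Real.exp (-(δ * distEU P j x₂ y')) := by
        rw [← Finset.mul_sum]; ring
    _ ≤ ED * MCj * EU * (P.d : ℝ) ^ 2 * (Real.exp (min δ δC / 2 / 2) * ((2 * (1 + P.d / (min δ δC / 2))) ^ P.d) ^ 2 *
          Real.exp (-(min δ δC / 2 * ((supDist x x₂ : ℝ) / (P.L : ℝ) ^ j)))) :=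
        mul_le_mul_of_nonneg_left (triple_sum_le hj hδ hδC x x₂) (by positivity)
    _ = _ := by
        rw [hED, hEU, hx₂]
        have hℓ0 : ℓ ≠ 0 := (lt_of_lt_of_le one_pos (one_le_pow₀ (by exact_mod_cast P.L_pos) : (1:ℝ) ≤ ℓ)).ne'
        field_simp

/-! ## §2  The scale-`j` term -/

/-- **THE SCALE-`j` TERM OF THE KERNEL OF `C_k` IS EXPONENTIALLY SMALL** (normalisation of record; `j ≤ k ≤ m + K`): for every fine site `x`
and unit bond `b′`, `|(D_jC^{(j)}H_j^*∂*Q^{e*}_k∂₁e_{b′})(x)| ≤ N_∂·(2d³M²e^{δ}M_{C,j}K₀)·e^{(δ+a₀)L^{k−j}}·e^{−a₀L^{k−j}dist(x,b′)}`,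
`N_∂ = 4e^d d²(2(1+1))^d`, `a₀ = min(δ,δ_C)/2` — file 1's `termCk_eq_sum`, §1 at each source plaquette `p` with `(∂₁e_{b′})(p) ≠ 0` (then
`|p₋ − b′₋|_∞ ≤ 1`, so `|x − ctr_k p₋|_∞ ≥ |x − ctr_k b′₋|_∞ − L^k`: one factor `e^{a₀L^{k−j}}`), and file 1's `ℓ¹` bound
`sum_abs_curl_single_le` of the source (curl factor `L^k/L^k = 1`). [cite: BalabanImbrieJaffe1988, (2.23) p.262] -/
theorem abs_termCk_le (hd : 2 ≤ P.d) {k : ℕ} (hk : k ≤ P.m + P.K) {j : ℕ} (hj : j ≤ P.m + P.K) (hjk : j ≤ k)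
    {a : ℝ} (ha : 0 < a) {δ M δC MCj : ℝ} (hδ : 0 < δ) (hδC : 0 < δC) (hM : 0 ≤ M) (hMCj : 0 ≤ MCj)
    (hH : ∀ (μ ν : Fin P.d) (x'' : TSite P 0) (y : TSite P j),
      |(torusRep P j (deltaAData hj a)).H (x'', μ) (y, ν)| ≤ M * Real.exp (-(δ * distEU P j x'' y)))
    (hB : ∀ (μ ν : Fin P.d) (x : TSite P 0) (y : TSite P j),
      ‖fun lam : Fin P.d => (P.L : ℝ) ^ j *
          ((torusRep P j (deltaAData hj a)).H (x.shift lam, μ) (y, ν) - (torusRep P j (deltaAData hj a)).H (x, μ) (y, ν))‖ ≤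
        M * Real.exp (-(δ * distEU P j x y)))
    (hC : ∀ b b' : PBond P j, |⟪toEj P j (Pi.single b 1),
      CE P ((P.eta k) ^ P.d) ((P.L : ℝ) ^ k) j (toEj P j (Pi.single b' 1))⟫| ≤ MCj * Real.exp (-(δC * (supDist b.src b'.src : ℝ))))
    (x : TSite P 0) (b' : PBond P k) :
    |DjE P ((P.eta k) ^ P.d) ((P.L : ℝ) ^ k) j (CE P ((P.eta k) ^ P.d) ((P.L : ℝ) ^ k) j
      (LinearMap.adjoint (HkE P ((P.eta k) ^ P.d) ((P.L : ℝ) ^ k) j)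
        (LinearMap.adjoint (curlOp (P := P) ((P.eta k) ^ P.d) ((P.L : ℝ) ^ k))
          (QesOp (P := P) hd ((P.eta k) ^ P.d) k (dOne P k ((P.L : ℝ) ^ k) (toEj P k (Pi.single b' 1))))))) x| ≤
      4 * (Real.exp P.d * ((P.d : ℝ) ^ 2 * (2 * (1 + (1:ℝ)⁻¹)) ^ P.d)) *
        (2 * (P.d : ℝ) ^ 3 * M ^ 2 * Real.exp δ * MCj *
          (Real.exp (min δ δC / 2 / 2) * ((2 * (1 + P.d / (min δ δC / 2))) ^ P.d) ^ 2)) *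
        Real.exp ((δ + min δ δC / 2) * (P.L : ℝ) ^ (k - j)) *
        Real.exp (-(min δ δC / 2 * ((P.L : ℝ) ^ (k - j) * distEU P k x b'.src))) := by
  set a₀ : ℝ := min δ δC / 2 with ha₀
  have ha₀p : 0 < a₀ := by rw [ha₀]; exact half_pos (lt_min hδ hδC)
  set ℓ : ℝ := (P.L : ℝ) ^ (k - j) with hℓ
  set K₀ : ℝ := Real.exp (a₀ / 2) * ((2 * (1 + P.d / a₀)) ^ P.d) ^ 2 with hK₀
  set N : ℝ := 4 * (Real.exp P.d * ((P.d : ℝ) ^ 2 * (2 * (1 + (1:ℝ)⁻¹)) ^ P.d)) with hN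
  set G : ℝ := 2 * (P.d : ℝ) ^ 3 * M ^ 2 * Real.exp δ * MCj * K₀ with hG
  set D : ℝ := distEU P k x b'.src with hDdef
  have hG0 : 0 ≤ G := by positivity
  have hLk := cast_pow_L_pos' (P := P) k
  have hLj := cast_pow_L_pos' (P := P) j
  -- the source `∂₁e_{b′}` has lattice factor `L^k/L^k = 1`
  have hf : ∀ p : TPlaq P k, dOne P k ((P.L : ℝ) ^ k) (toEj P k (Pi.single b' 1)) p = curl 1 (Pi.single b' (1 : ℝ)) p := by
    intro p; rw [dOne_single_apply, div_self hLk.ne']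
  rw [termCk_eq_sum]
  -- per source plaquette
  have hpt : ∀ p : TPlaq P k,
      |dOne P k ((P.L : ℝ) ^ k) (toEj P k (Pi.single b' 1)) p *
        ∑ b₁ : PBond P j, ∑ b₂ : PBond P j, DjE P ((P.eta k) ^ P.d) ((P.L : ℝ) ^ k) j (toEj P j (Pi.single b₁ 1)) x *
          ⟪toEj P j (Pi.single b₁ 1), CE P ((P.eta k) ^ P.d) ((P.L : ℝ) ^ k) j (toEj P j (Pi.single b₂ 1))⟫ *
          LinearMap.adjoint (HkE P ((P.eta k) ^ P.d) ((P.L : ℝ) ^ k) j)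
            (LinearMap.adjoint (curlOp (P := P) ((P.eta k) ^ P.d) ((P.L : ℝ) ^ k))
              (QesOp (P := P) hd ((P.eta k) ^ P.d) k (toU P k (Pi.single p 1)))) b₂| ≤
        |curl 1 (Pi.single b' (1 : ℝ)) p| * (G * Real.exp ((δ + a₀) * ℓ) * Real.exp (-(a₀ * (ℓ * D)))) := by
    intro p
    rw [abs_mul, hf p]
    by_cases h0 : curl 1 (Pi.single b' (1 : ℝ)) p = 0
    · rw [h0, abs_zero, zero_mul, zero_mul]
    · refine mul_le_mul_of_nonneg_left ?_ (abs_nonneg _)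
      have hrel := supDist_le_one_of_curl_single_ne_zero 1 b' p h0
      have hS := abs_tripleCk_le hd hk hj hjk ha hδ hδC hM hMCj hH hB hC x p
      refine hS.trans ?_
      rw [← ha₀, ← hK₀, ← hℓ]
      have e1 : 2 * (P.d : ℝ) ^ 3 * M ^ 2 * Real.exp δ * MCj * Real.exp (δ * ℓ) * K₀ *
          Real.exp (-(a₀ * ((supDist x (ctr k p.src) : ℝ) / (P.L : ℝ) ^ j))) =
          G * (Real.exp (δ * ℓ) * Real.exp (-(a₀ * ((supDist x (ctr k p.src) : ℝ) / (P.L : ℝ) ^ j)))) := by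
        rw [hG]; ring
      rw [e1, mul_assoc G]
      refine mul_le_mul_of_nonneg_left ?_ hG0
      rw [← Real.exp_add, ← Real.exp_add]
      refine Real.exp_le_exp.2 ?_
      -- `supDist x (ctr p) / L^j ≥ ℓ D − ℓ`
      have h1 : (supDist x (ctr k b'.src) : ℝ) ≤ (supDist x (ctr k p.src) : ℝ) + (P.L : ℝ) ^ k := by
        have t := supDist_triangle x (ctr k p.src) (ctr k b'.src)
        rw [supDist_ctr_ctr hk] at t
        have t2 : supDist x (ctr k b'.src) ≤ supDist x (ctr k p.src) + P.L ^ k :=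
          t.trans (Nat.add_le_add_left (by nlinarith [hrel, Nat.one_le_pow k P.L P.L_pos]) _)
        exact_mod_cast t2
      have h2 : ℓ * D - ℓ ≤ (supDist x (ctr k p.src) : ℝ) / (P.L : ℝ) ^ j := by
        rw [hDdef, distEU, hℓ, le_div_iff₀ hLj]
        have e2 : ((P.L : ℝ) ^ (k - j) * ((supDist x (ctr k b'.src) : ℝ) / (P.L : ℝ) ^ k) - (P.L : ℝ) ^ (k - j)) *
            (P.L : ℝ) ^ j = (supDist x (ctr k b'.src) : ℝ) - (P.L : ℝ) ^ k := by
          rw [sub_mul, mul_assoc, mul_comm _ ((P.L:ℝ)^j), ← mul_assoc, ← pow_add, Nat.sub_add_cancel hjk]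
          field_simp
        rw [e2]
        linarith
      nlinarith [mul_le_mul_of_nonneg_left h2 ha₀p.le]
  have hN1 := sum_abs_curl_single_le hd (k := k) 1 b'
  rw [abs_one, mul_one] at hN1
  calc _ ≤ ∑ p : TPlaq P k, |curl 1 (Pi.single b' (1 : ℝ)) p| * (G * Real.exp ((δ + a₀) * ℓ) * Real.exp (-(a₀ * (ℓ * D)))) :=
        (Finset.abs_sum_le_sum_abs _ _).trans (Finset.sum_le_sum fun p _ => hpt p)
    _ = (∑ p : TPlaq P k, |curl 1 (Pi.single b' (1 : ℝ)) p|) * (G * Real.exp ((δ + a₀) * ℓ) * Real.exp (-(a₀ * (ℓ * D)))) := by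
        rw [Finset.sum_mul]
    _ ≤ N * (G * Real.exp ((δ + a₀) * ℓ) * Real.exp (-(a₀ * (ℓ * D)))) :=
        mul_le_mul_of_nonneg_right hN1 (by positivity)
    _ = _ := by rw [hN, hG]; ring

end

end Literature.MathematicalPhysics.QuantumFieldTheory.BalabanImbrieJaffe1984to88.BIJ88Decay223CkTerm
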